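import Summits.ValiantsHypothesis.ValiantsHypothesis.Theorems.BarrierLeverSigmaPiSigmaSliceCertificate
import Summits.ValiantsHypothesis.ValiantsHypothesis.Theorems.BarrierLeverSigmaLambdaSigmaSliceEquations

/-!
# Route BarrierLever — the MODEL axis of crux `DefinableEquations` (stmt-ValiantsHypothesis-8745) /
# item `SingleSizeEquations` (8749): the `∃ a ∀ b` natural proof against the HOMOGENEOUS depth-3
# (`ΣΠΣ`) slice — part 2/2: non-vanishing, constructivity, thresholds, and the headline

Continuation of `…SigmaPiSigmaSliceCertificate.lean` (the order-`k` square-free catalecticant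
`spsCert n`, `k = ⌊n/9⌋`, and its vanishing on `sigmaPiSigmaSlice n s` whenever
`s · C(2k,k) < C(n,k)`).  Here: NON-VANISHING at the explicit witness
`esqWitness n = e_k(x_0²,…,x_{n-1}²) = Σ_{|S|=k} x^{2S}` (degree `2k ≤ n`; the evaluated matrix is
diagonal with entries `2^k`, `eval_spsCert_esqWitness_ne_zero`); CONSTRUCTIVITY
(`spsCert_mem_distinguishers`: size `≤ 8 (C(n,k)+1)⁷ + C(n,k)²`, degree `≤ C(n,k)`, level 18); the
natural proof `isNaturalProof_spsCert`; the ARITHMETIC `2^k · C(2k,k) ≤ 8^k ≤ C(n,k)` (`9k ≤ n`) and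
`n^b < 2^{⌊n/9⌋}` for `n ≥ 162 · 16^b`; and the HEADLINES: `naturalProofsAgainstSigmaPiSigma`
(ONE level `a = 18` such that for EVERY `b`, eventually, the degree-`≤ n` polynomials computed by
homogeneous `ΣΠΣ` circuits of top fan-in `n^b` are not a succinct hitting set for
`Distinguishers ℂ n a` — the sentence of `DefinableEquations` with its quantifier order, on the
homogeneous depth-3 slice), its boolean-sum form `sigmaPiSigmaSliceEquations` (`q = 0`), the
EXPONENTIAL form `not_isSuccinctHittingSet_sigmaPiSigma_of_lt_two_pow` (every top fan-in
`s < 2^{⌊n/9⌋}` at the same level), and the explicit Nisan–Wigderson-type bound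
`esqWitness_not_mem_slice` (`e_k(x²)` is not a sum of fewer than `C(n,k)/C(2k,k)` products of linear
forms).
WHAT THIS IS NOT: nothing on general circuits (the crux, CT23 dir. 2), on non-homogeneous `ΣΠΣ`,
formulas beyond `n²/20`, 8746, 14610 or VP vs VNP; classical (Nisan–Wigderson 1996) mathematics made
FSV-natural and kernel-checked.
-/

-- layout Summits/ValiantsHypothesis/ValiantsHypothesis forces the duplicated namespace component
set_option linter.dupNamespace false

noncomputable section

open MvPolynomial Finsupp

namespace Summit.ValiantsHypothesis.ValiantsHypothesis.Theorems.BarrierLever.SigmaPiSigmaSlice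

open Literature.Computability.AlgebraicComplexity Literature.Barriers.ValiantsHypothesis
open SigmaLambdaSigmaSlice (pow_lt_two_pow_of_le degree_sqfree)

section slice

variable {n : ℕ}

/-! ## Non-vanishing at `e_k(x_0², …, x_{n-1}²)` -/

/-- `x^{S'} x^{S'} = x^T x^S` forces `S' = T = S`. [folklore] -/
theorem sqfree_add_self_eq_iff (S' S T : Finset (Fin n)) :
    sqfree S' + sqfree S' = sqfree T + sqfree S ↔ S' = T ∧ S' = S := by
  refine ⟨fun h => ?_, by rintro ⟨rfl, rfl⟩; rfl⟩
  have key : ∀ i : Fin n, (i ∈ S' ↔ i ∈ T) ∧ (i ∈ S' ↔ i ∈ S) := by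
    intro i
    have := DFunLike.congr_fun h i
    simp only [Finsupp.add_apply, sqfree_apply] at this
    by_cases h1 : i ∈ S' <;> by_cases h2 : i ∈ T <;> by_cases h3 : i ∈ S <;>
      simp [h1, h2, h3] at this ⊢
  exact ⟨Finset.ext fun i => (key i).1, Finset.ext fun i => (key i).2⟩

/-- The coefficients of the witness on the coordinates `c_{x^S x^T}`: the identity pattern.
[folklore] -/
theorem coeff_esqWitness (S T : KSub n) :
    coeff (sqfree T.1 + sqfree S.1) (esqWitness n) = if S = T then 1 else 0 := by
  classical
  simp only [esqWitness, coeff_sum, coeff_monomial, sqfree_add_self_eq_iff]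
  by_cases hST : S = T
  · subst hST
    rw [if_pos rfl, Finset.sum_eq_single S]
    · rw [if_pos ⟨rfl, rfl⟩]
    · intro S' _ hS'
      exact if_neg fun h => hS' (Subtype.ext h.1)
    · simp
  · rw [if_neg hST]
    exact Finset.sum_eq_zero fun S' _ => if_neg fun h =>
      hST (Subtype.ext (h.2.symm.trans h.1))

/-- The diagonal weights `w(S,S) = 2^{|S|}` are nonzero. [folklore] -/
theorem spsWeight_self_ne_zero (S : KSub n) : (spsWeight n S S : ℂ) ≠ 0 := by
  classical
  rw [spsWeight, Nat.cast_ne_zero, Finset.prod_ne_zero_iff]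
  intro i hi
  have h0 := Finsupp.mem_support_iff.mp hi
  have h1 : sqfree S.1 i = 1 := by
    rw [sqfree_apply] at h0 ⊢
    split_ifs with h
    · rfl
    · exact absurd (if_neg h) h0
  rw [Finsupp.add_apply, h1]
  decide

/-- **The certificate does not vanish at the witness** `e_k(x²)`: the evaluated matrix is
diagonal with entries `2^k`. [cite: NisanWigderson1996, §3 (Theorem 0)] -/
theorem eval_spsCert_esqWitness_ne_zero :
    eval (coeffVector (degLEMonomials n) (esqWitness n)) (spsCert n) ≠ 0 := by
  classical
  rw [eval_spsCert]
  have hM : (Matrix.of fun S T => (spsWeight n S T : ℂ) *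
      coeffVector (degLEMonomials n) (esqWitness n) (spsCoord n S T)) =
      Matrix.diagonal fun S => (spsWeight n S S : ℂ) := by
    ext S T
    rw [Matrix.of_apply, coeffVector_apply, Matrix.diagonal_apply]
    show (spsWeight n S T : ℂ) * coeff (sqfree T.1 + sqfree S.1) (esqWitness n) = _
    rw [coeff_esqWitness]
    split_ifs with h
    · subst h; rw [mul_one]
    · rw [mul_zero]
  rw [hM, Matrix.det_diagonal]
  exact Finset.prod_ne_zero_iff.mpr fun S _ => spsWeight_self_ne_zero S

/-- `spsCert n ≠ 0`. [folklore] -/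
theorem spsCert_ne_zero : spsCert n ≠ 0 := fun h =>
  eval_spsCert_esqWitness_ne_zero (n := n) (by rw [h, map_zero])

/-- The witness has degree `≤ n` (indeed `2⌊n/9⌋`). [folklore] -/
theorem totalDegree_esqWitness_le : (esqWitness n).totalDegree ≤ n := by
  classical
  refine (totalDegree_finsetSum _ _).trans (Finset.sup_le fun S _ => ?_)
  refine (totalDegree_monomial_le _ _).trans ?_
  have h := degree_sqfree_add_sqfree_le n S S
  simpa [Finsupp.sum, Finsupp.degree_apply] using h

/-! ## Constructivity: a level-18 distinguisher -/

/-- `deg (spsCert n) ≤ C(n, ⌊n/9⌋)`. [folklore] -/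
theorem totalDegree_spsCert_le : (spsCert n).totalDegree ≤ n.choose (n / 9) := by
  classical
  refine (NaturalProofsAgainstAllLinearSizes.totalDegree_det_le_card _ fun S T => ?_).trans
    (by rw [Fintype.card_finset_len, Fintype.card_fin])
  rw [spsMatrix, Matrix.of_apply]
  refine (totalDegree_mul _ _).trans ?_
  rw [totalDegree_C, totalDegree_X, zero_add]

/-- `L(spsCert n) ≤ 8 (C(n,k) + 1)⁷ + C(n,k)²`, `k = ⌊n/9⌋`. [folklore] -/
theorem complexity_spsCert_le :
    complexity (spsCert n) ≤ 8 * (n.choose (n / 9) + 1) ^ 7 + (n.choose (n / 9)) ^ 2 * 1 := by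
  classical
  have h := NaturalProofsAgainstAllLinearSizes.complexity_det_le (spsMatrix n) 1 fun S T => by
    rw [spsMatrix, Matrix.of_apply]
    refine (complexity_mul_le_holds _ _).trans ?_
    rw [complexity_C_holds, complexity_X_holds]
  rwa [Fintype.card_finset_len, Fintype.card_fin] at h

/-- **Constructivity**: `spsCert n ∈ Distinguishers ℂ n 18` for `n ≥ 1`. [folklore] -/
theorem spsCert_mem_distinguishers (hn : 1 ≤ n) : spsCert n ∈ Distinguishers ℂ n 18 := by
  set N := (2 * n).choose n with hNdef
  have h2N : 2 ^ n ≤ N := Literature.ModelTheory.FiniteModelTheory.two_pow_le_choose_two_mul_self n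
  have hK : n.choose (n / 9) ≤ N := (Nat.choose_le_two_pow n (n / 9)).trans h2N
  have hN2 : 2 ≤ N := le_trans (by
    calc (2 : ℕ) = 2 ^ 1 := by norm_num
      _ ≤ 2 ^ n := Nat.pow_le_pow_right (by norm_num) hn) h2N
  have h1024 : 1024 ≤ N ^ 10 := by
    calc (1024 : ℕ) = 2 ^ 10 := by norm_num
      _ ≤ N ^ 10 := Nat.pow_le_pow_left hN2 10
  refine ⟨complexity_spsCert_le.trans ?_, totalDegree_spsCert_le.trans (hK.trans ?_)⟩
  · calc 8 * (n.choose (n / 9) + 1) ^ 7 + (n.choose (n / 9)) ^ 2 * 1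
        ≤ 8 * (2 * N) ^ 7 + N ^ 2 := by
          have : n.choose (n / 9) + 1 ≤ 2 * N := by omega
          exact Nat.add_le_add (Nat.mul_le_mul_left 8 (Nat.pow_le_pow_left this 7))
            (by rw [mul_one]; exact Nat.pow_le_pow_left hK 2)
      _ = 1024 * N ^ 7 + N ^ 2 := by ring
      _ ≤ N ^ 10 * N ^ 7 + N ^ 17 := Nat.add_le_add (Nat.mul_le_mul_right _ h1024)
          (Nat.pow_le_pow_right (by omega) (by norm_num))
      _ = 2 * N ^ 17 := by ring
      _ ≤ N * N ^ 17 := Nat.mul_le_mul_right _ hN2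
      _ = N ^ 18 := by ring
  · calc N = N ^ 1 := (pow_one N).symm
      _ ≤ N ^ 18 := Nat.pow_le_pow_right (by omega) (by norm_num)

/-! ## The natural proof and the arithmetic of the threshold -/

/-- **Natural proof against the homogeneous depth-3 slice** at every top fan-in `s` with
`s · C(2k,k) < C(n,k)`, `k = ⌊n/9⌋` (`n ≥ 1`). [cite: ForbesShpilkaVolk2018, Def. 1] -/
theorem isNaturalProof_spsCert {s : ℕ} (hn : 1 ≤ n)
    (hs : s * (2 * (n / 9)).choose (n / 9) < n.choose (n / 9)) :
    IsNaturalProof (degLEMonomials n) (sigmaPiSigmaSlice n s) (Distinguishers ℂ n 18)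
      (spsCert n) :=
  ⟨spsCert_mem_distinguishers hn, spsCert_ne_zero, fun _ hf => eval_spsCert_eq_zero_of_mem hs hf⟩

/-- `c^k ≤ C(n,k)` whenever `(c+1) k ≤ n`. [folklore] -/
theorem pow_le_choose_of_mul_le (c : ℕ) : ∀ k n : ℕ, (c + 1) * k ≤ n → c ^ k ≤ n.choose k := by
  intro k
  induction k with
  | zero => intro n _; simp
  | succ k ih =>
    intro n h
    have hk : c ^ k ≤ n.choose k := ih n (le_trans (Nat.mul_le_mul_left _ (Nat.le_succ k)) h)
    have hnk : c * (k + 1) ≤ n - k := by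
      have : (c + 1) * (k + 1) = c * (k + 1) + (k + 1) := by ring
      omega
    have key : c ^ (k + 1) * (k + 1) ≤ n.choose (k + 1) * (k + 1) := by
      calc c ^ (k + 1) * (k + 1) = c ^ k * (c * (k + 1)) := by ring
        _ ≤ n.choose k * (n - k) := Nat.mul_le_mul hk hnk
        _ = n.choose (k + 1) * (k + 1) := (Nat.choose_succ_right_eq n k).symm
    exact Nat.le_of_mul_le_mul_right key (Nat.succ_pos k)

/-- `2^k · C(2k,k) ≤ C(n,k)` whenever `9k ≤ n` (`C(2k,k) ≤ 4^k` and `8^k ≤ C(n,k)`). [folklore] -/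
theorem two_pow_mul_centralBinom_le_choose {k : ℕ} (hk : 9 * k ≤ n) :
    2 ^ k * (2 * k).choose k ≤ n.choose k := by
  calc 2 ^ k * (2 * k).choose k ≤ 2 ^ k * 4 ^ k := by
        refine Nat.mul_le_mul_left _ ((Nat.choose_le_two_pow (2 * k) k).trans ?_)
        rw [pow_mul]; norm_num
    _ = 8 ^ k := by rw [← mul_pow]; norm_num
    _ ≤ n.choose k := pow_le_choose_of_mul_le 8 k n (by omega)

/-- If `s < 2^k` and `9k ≤ n` then `s · C(2k,k) < C(n,k)`. [folklore] -/
theorem mul_centralBinom_lt_choose_of_lt_two_pow {s k : ℕ} (hk : 9 * k ≤ n) (hs : s < 2 ^ k) :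
    s * (2 * k).choose k < n.choose k :=
  lt_of_lt_of_le (Nat.mul_lt_mul_of_pos_right hs (Nat.choose_pos (by omega)))
    (two_pow_mul_centralBinom_le_choose hk)

/-- The threshold: `n^b < 2^{⌊n/9⌋}` for `n ≥ 162 · 16^b`. [folklore] -/
theorem pow_lt_two_pow_ninth {b n : ℕ} (hn : 162 * 16 ^ b ≤ n) : n ^ b < 2 ^ (n / 9) := by
  have hk : 18 * 16 ^ b ≤ n / 9 := by omega
  have h16 : 1 ≤ 16 ^ b := Nat.one_le_pow _ _ (by norm_num)
  have hk18 : 18 ≤ n / 9 := le_trans (by omega) hk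
  have hn18 : n ≤ 18 * (n / 9) := by omega
  have hsq : 18 * (n / 9) ≤ (n / 9) * (n / 9) := Nat.mul_le_mul_right _ hk18
  have h4 : 4 ^ (2 * b) ≤ n / 9 := by
    rw [pow_mul, show (4 : ℕ) ^ 2 = 16 by norm_num]
    omega
  calc n ^ b ≤ (18 * (n / 9)) ^ b := Nat.pow_le_pow_left hn18 b
    _ ≤ ((n / 9) * (n / 9)) ^ b := Nat.pow_le_pow_left hsq b
    _ = (n / 9) ^ (2 * b) := by rw [← sq, ← pow_mul]
    _ < 2 ^ (n / 9) := pow_lt_two_pow_of_le (2 * b) (n / 9) h4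

/-- The threshold in the certificate's form: `n^b · C(2k,k) < C(n,k)`, `k = ⌊n/9⌋`, for
`n ≥ 162 · 16^b`. [folklore] -/
theorem pow_mul_centralBinom_lt_choose {b n : ℕ} (hn : 162 * 16 ^ b ≤ n) :
    n ^ b * (2 * (n / 9)).choose (n / 9) < n.choose (n / 9) :=
  mul_centralBinom_lt_choose_of_lt_two_pow (by omega) (pow_lt_two_pow_ninth hn)

/-- **Largeness inside the slice — an explicit Nisan–Wigderson bound**: the witness
`e_k(x_0²,…,x_{n-1}²)` (degree `≤ n`) is a non-root of the certificate, hence lies outside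
`sigmaPiSigmaSlice n s` whenever `s · C(2k,k) < C(n,k)`, `k = ⌊n/9⌋`: it is not a sum of at most
`s` products of linear forms (e.g. for every `s < 2^{⌊n/9⌋}`).
[cite: NisanWigderson1996, §3 (Theorem 0)] -/
theorem esqWitness_not_mem_slice {s : ℕ} (hs : s * (2 * (n / 9)).choose (n / 9) < n.choose (n / 9)) :
    (esqWitness n).totalDegree ≤ n ∧ esqWitness n ∉ sigmaPiSigmaSlice n s :=
  ⟨totalDegree_esqWitness_le, fun hf =>
    eval_spsCert_esqWitness_ne_zero (eval_spsCert_eq_zero_of_mem hs hf)⟩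

/-- **Exponential top fan-in at one level**: for `n ≥ 9` and every `s < 2^{⌊n/9⌋}`, the
homogeneous depth-3 slice of top fan-in `s` is not a succinct hitting set for `Distinguishers ℂ n 18`.
[cite: NisanWigderson1996, §3 (Theorem 0)] -/
theorem not_isSuccinctHittingSet_sigmaPiSigma_of_lt_two_pow (hn : 9 ≤ n) {s : ℕ}
    (hs : s < 2 ^ (n / 9)) :
    ¬ IsSuccinctHittingSet (degLEMonomials n) (sigmaPiSigmaSlice n s) (Distinguishers ℂ n 18) :=
  (exists_isNaturalProof_iff _ _ _).mp
    ⟨_, isNaturalProof_spsCert (by omega) (mul_centralBinom_lt_choose_of_lt_two_pow (by omega) hs)⟩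

end slice

/-- **HEADLINE — the crux's quantifier shape `∃ a ∀ b` on the homogeneous depth-3 slice.**  There
is ONE level `a` (`= 18`) such that for EVERY size exponent `b`, for all `n ≥ 162 · 16^b`, the
polynomials of degree `≤ n` in `n` variables that are sums of at most `n^b` products of (at most `n`)
linear forms — i.e. computed by homogeneous `ΣΠΣ` circuits of top fan-in `n^b` — are NOT a succinct
hitting set for `Distinguishers ℂ n a`: `DefinableEquations` (item 8745, `∃ a ∀ b ∃ n₀ ∀ n ≥ n₀ …`)
holds verbatim with `SmallCircuits ℂ n b` replaced by `sigmaPiSigmaSlice n (n ^ b)`, with `q = 0`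
boolean variables. [cite: NisanWigderson1996, §3 (Theorem 0) and §5.1] -/
theorem naturalProofsAgainstSigmaPiSigma : ∃ a : ℕ, ∀ b : ℕ, ∃ n₀ : ℕ, ∀ n ≥ n₀,
    ¬ IsSuccinctHittingSet (degLEMonomials n) (sigmaPiSigmaSlice n (n ^ b))
      (Distinguishers ℂ n a) := by
  refine ⟨18, fun b => ⟨162 * 16 ^ b, fun n hn => ?_⟩⟩
  have hn1 : 1 ≤ n := le_trans (by have := Nat.one_le_pow b 16 (by norm_num); omega) hn
  exact (exists_isNaturalProof_iff _ _ _).mp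
    ⟨_, isNaturalProof_spsCert hn1 (pow_mul_centralBinom_lt_choose hn)⟩

/-- **The 8745-shaped statement on the slice** (boolean-sum form): ONE level `a = 18` such that
for every `b` and all `n ≥ 162 · 16^b` a nonzero level-`a` boolean sum in the coefficient variables
(here with `q = 0` boolean variables) vanishes at `coeff f` for every
`f ∈ sigmaPiSigmaSlice n (n^b)`. [cite: NisanWigderson1996, §3 (Theorem 0) and §5.1] -/
theorem sigmaPiSigmaSliceEquations : ∃ a : ℕ, ∀ b : ℕ, ∃ n₀ : ℕ, ∀ n ≥ n₀,
    ∃ q : ℕ, q ≤ (Nat.choose (2 * n) n) ^ a ∧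
      ∃ H : MvPolynomial (↥(degLEMonomials n) ⊕ Fin q) ℂ,
        complexity H ≤ (Nat.choose (2 * n) n) ^ a ∧ H.totalDegree ≤ (Nat.choose (2 * n) n) ^ a ∧
        boolSum H ≠ 0 ∧
        ∀ f ∈ sigmaPiSigmaSlice n (n ^ b),
          eval (coeffVector (degLEMonomials n) f) (boolSum H) = 0 := by
  refine ⟨18, fun b => ⟨162 * 16 ^ b, fun n hn =>
    ⟨0, Nat.zero_le _, MvPolynomial.rename Sum.inl (spsCert n), ?_⟩⟩⟩
  have hn1 : 1 ≤ n := le_trans (by have := Nat.one_le_pow b 16 (by norm_num); omega) hn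
  obtain ⟨hD, hne, hvan⟩ := isNaturalProof_spsCert hn1 (pow_mul_centralBinom_lt_choose hn)
  obtain ⟨hc, hdeg, hsum⟩ := SingleSizeEquations.distinguisher_isBoolSum hD
  refine ⟨hc, hdeg, by rwa [hsum], fun f hf => ?_⟩
  rw [hsum]
  exact hvan f hf

end Summit.ValiantsHypothesis.ValiantsHypothesis.Theorems.BarrierLever.SigmaPiSigmaSlice

end
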